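import Literature.MathematicalPhysics.QuantumLattice.LiebWuFiniteBFixedPoint
import Literature.MathematicalPhysics.QuantumLattice.LiebWuIntegralEquationsExistence
import HarnessLib

/-!
# Lieb–Wu 2003, Theorem 1: existence of the solution of (13)–(14) for every rapidity range `0 < B ≤ ∞`

Family `hubbard`. Lieb–Wu, PRL 20 (1968) 1445, statement (a): "Equations (13)–(16) have a unique
solution which is positive for all allowed `B` and `Q`"; Physica A 321 (2003) 1, §5, THEOREM 1.
`LiebWuIntegralEquationsExistence` assembled the `B = ∞` solution; this file does the same for a
general rapidity range `S` (printed case `S = [-B, B]`, `0 < B < ∞`) from the Neumann-series solution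
`σ_S = liebWuSigmaAtS U Q S` of eq. (S) (`LiebWuFiniteBNeumannSeries`, `LiebWuFiniteBFixedPoint`):

* `liebWuRhoAtS U Q S k = 1/2π + cos k ∫ 1_S(t) σ_S(t) K_{U/4}(sin k - t) dt` — eq. (13) with the
  rapidity integral over `S`;
* `liebWuSigmaAtS_eq_kernel_form`: **for every real `Λ`**,
  `σ_S(Λ) = ∫_{-Q}^{Q} K_{U/4}(Λ - sin k) ρ_S(k) dk - ∫_S K_{U/2}(Λ - Λ') σ_S(Λ') dΛ'` — eq. (14) in
  kernel form, valid on all of `ℝ` (Lieb–Wu: "Although these equations have to be solved in the stated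
  intervals we can use their right sides to define their left sides for all real `x`"); obtained from the
  fixed point `σ_S = ξ + Ŵσ_S` by applying `1 + K̂²` through the kernel identities `r ∗ K² = 2K - r`,
  `u ∗ K² = K² - u`;
* `isLiebWuDensities_liebWuRhoAtS_liebWuSigmaAtS`: for `U > 0`, `0 < Q ≤ π`, `0 < B`, the pair
  `(ρ_S, σ_S)`, `S = [-B, B]`, satisfies the printed equations (13)–(14) (`IsLiebWuDensities U Q (Icc (-B) B)`),
  with `σ_S > 0` everywhere — existence and positivity of `σ` in statement (a) for finite `B`.

No named fact; uniqueness for finite `B` and the positivity of `ρ` (Lemma 3) are separate files.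

## References

* E. H. Lieb, F. Y. Wu, Physica A 321 (2003) 1–27 = arXiv:cond-mat/0207529, §5, Theorem 1, eqs. (S),
  (R), (W), (series) (key `LiebWuPhysicaA2003`); PRL 20 (1968) 1445, statement (a) (`LiebWuPRL1968`).
-/

noncomputable section

open MeasureTheory Set Real Filter intervalIntegral
open Literature.Analysis.SpecialFunctions Literature.Analysis.FunctionSpaces
open scoped Convolution Topology

namespace Literature.MathematicalPhysics.QuantumLattice

namespace LiebWuExistenceS

variable {f g k : ℝ → ℝ} {B B' : ℝ}

/-- `t ↦ f(t) g(x - t)` is integrable for `f ∈ L¹`, `g` bounded continuous. [folklore] -/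
private theorem integrable_mul_sub₃ (hf : Integrable f) (hgc : Continuous g) (hgB : ∀ y, |g y| ≤ B)
    (x : ℝ) : Integrable fun t => f t * g (x - t) :=
  hf.mul_bdd (hgc.comp (continuous_const.sub continuous_id)).aestronglyMeasurable
    (Eventually.of_forall fun t => by rw [Real.norm_eq_abs]; exact hgB _)

/-- `x ↦ ∫ f(t) g(x - t) dt` is continuous for `f ∈ L¹`, `g` bounded continuous. [folklore] -/
private theorem continuous_conv₃ (hf : Integrable f) (hgc : Continuous g) (hgB : ∀ y, |g y| ≤ B) :
    Continuous fun x => ∫ t, f t * g (x - t) := by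
  have h : (fun x => ∫ t, f t * g (x - t)) = f ⋆[ContinuousLinearMap.mul ℝ ℝ, volume] g := by
    funext x; rw [convolution_def]; simp only [ContinuousLinearMap.mul_apply']
  rw [h]
  refine BddAbove.continuous_convolution_right_of_integrable (L := ContinuousLinearMap.mul ℝ ℝ)
    ⟨B, ?_⟩ hf hgc
  rintro _ ⟨y, rfl⟩
  exact (Real.norm_eq_abs _).trans_le (hgB y)

/-- The convolution of an integrable function with an integrable kernel is integrable. [folklore] -/
private theorem integrable_conv₃ (hf : Integrable f) (hg : Integrable g) :
    Integrable (fun x => ∫ t, f t * g (x - t)) := by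
  have h : (fun x => ∫ t, f t * g (x - t)) = f ⋆[ContinuousLinearMap.mul ℝ ℝ, volume] g := by
    funext x; rw [convolution_def]; simp only [ContinuousLinearMap.mul_apply']
  rw [h]
  exact hf.integrable_convolution _ hg

/-- Linearity of `g ↦ ∫ f(t) g(x - t) dt`. [folklore] -/
private theorem conv_sub_right₃ (hf : Integrable f) (hgc : Continuous g) (hgB : ∀ y, |g y| ≤ B)
    (hkc : Continuous k) (hkB : ∀ y, |k y| ≤ B') (x : ℝ) :
    ∫ t, f t * (g (x - t) - k (x - t)) = (∫ t, f t * g (x - t)) - ∫ t, f t * k (x - t) := by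
  rw [← integral_sub (integrable_mul_sub₃ hf hgc hgB x) (integrable_mul_sub₃ hf hkc hkB x)]
  refine MeasureTheory.integral_congr_ae (Eventually.of_forall fun t => ?_)
  ring

/-- Associativity `((f ∗ g) ∗ k)(x) = (f ∗ (g ∗ k))(x)` for `f, g ∈ L¹`, `k` bounded continuous. [folklore] -/
private theorem conv_conv₃ (hf : Integrable f) (hgi : Integrable g) (hkc : Continuous k)
    (hkB : ∀ y, |k y| ≤ B') (x : ℝ) :
    ∫ y, (∫ z, f z * g (y - z)) * k (x - y) = ∫ z, f z * ∫ s, g s * k (x - z - s) := by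
  have hprod : Integrable (fun p : ℝ × ℝ => f p.2 * g (p.1 - p.2))
      ((volume : Measure ℝ).prod volume) :=
    hf.convolution_integrand (ContinuousLinearMap.mul ℝ ℝ) hgi
  have hkm : Continuous fun p : ℝ × ℝ => k (x - p.1) := hkc.comp (continuous_const.sub continuous_fst)
  have h := hprod.mul_bdd (c := B') hkm.aestronglyMeasurable
    (Eventually.of_forall fun p => by rw [Real.norm_eq_abs]; exact hkB _)
  have hF : Integrable (Function.uncurry fun y z => f z * g (y - z) * k (x - y))
      ((volume : Measure ℝ).prod volume) := h
  calc ∫ y, (∫ z, f z * g (y - z)) * k (x - y) = ∫ y, ∫ z, f z * g (y - z) * k (x - y) := by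
        refine MeasureTheory.integral_congr_ae (Eventually.of_forall fun y => ?_)
        exact (MeasureTheory.integral_mul_const (k (x - y)) _).symm
    _ = ∫ z, ∫ y, f z * g (y - z) * k (x - y) := integral_integral_swap hF
    _ = ∫ z, f z * ∫ s, g s * k (x - z - s) := by
        refine MeasureTheory.integral_congr_ae (Eventually.of_forall fun z => ?_)
        dsimp only
        rw [← MeasureTheory.integral_const_mul,
          ← integral_add_right_eq_self (fun y => f z * g (y - z) * k (x - y)) z]
        refine MeasureTheory.integral_congr_ae (Eventually.of_forall fun s => ?_)
        dsimp only
        rw [add_sub_cancel_right, show x - (s + z) = x - z - s by ring]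
        ring

end LiebWuExistenceS

open LiebWuExistenceS

/-- **The momentum density for the rapidity range `S`**, defined by eq. (13) from `σ_S = liebWuSigmaAtS U Q S`:
`ρ_S(k) = 1/2π + cos k · ∫ 1_S(t) σ_S(t) K_{U/4}(sin k - t) dt`. [cite: LiebWuPRL1968, eq. (13)] -/
def liebWuRhoAtS (U Q : ℝ) (S : Set ℝ) (k : ℝ) : ℝ :=
  1 / (2 * π) + Real.cos k * ∫ t, S.indicator (liebWuSigmaAtS U Q S) t * cauchyDensity (U / 4) (Real.sin k - t)

section Existence

variable {U Q : ℝ} {S : Set ℝ}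

/-- At `S = ℝ` this is the `B = ∞` density `liebWuRhoAt U Q`. [cite: LiebWuPRL1968, eq. (13)] -/
theorem liebWuRhoAtS_univ (U Q : ℝ) : liebWuRhoAtS U Q univ = liebWuRhoAt U Q := by
  funext k
  simp [liebWuRhoAtS, liebWuRhoAt, liebWuSigmaAtS_univ]

/-- `ρ_S` is continuous. [cite: LiebWuPhysicaA2003, §5, Theorem 1] -/
theorem continuous_liebWuRhoAtS (hU : 0 < U) (hQ : 0 < Q) (hS : MeasurableSet S) :
    Continuous (liebWuRhoAtS U Q S) := by
  have hc : 0 < U / 4 := by positivity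
  have hG : Continuous fun x => ∫ t, S.indicator (liebWuSigmaAtS U Q S) t * cauchyDensity (U / 4) (x - t) :=
    continuous_conv₃ ((integrable_liebWuSigmaAtS hU hQ hS).indicator hS) (continuous_cauchyDensity hc)
      (fun y => by rw [abs_of_pos (cauchyDensity_pos hc y)]; exact cauchyDensity_le hc y)
  unfold liebWuRhoAtS
  exact continuous_const.add (Real.continuous_cos.mul (hG.comp Real.continuous_sin))

/-- **Eq. (14) in kernel form, on all of `ℝ`** (the printed extension "use their right sides to define
their left sides for all real `x`"): for every real `Λ`,
`σ_S(Λ) = ∫_{-Q}^{Q} K_{U/4}(Λ - sin k) ρ_S(k) dk - ∫_S K_{U/2}(Λ - Λ') σ_S(Λ') dΛ'`.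
Proof: apply `1 + K̂²` to the fixed point `σ_S = ξ + Ŵσ_S` via `r ∗ K² = 2K - r`, `u ∗ K² = K² - u`, and
substitute `x = sin k` in the `k`-integral. [cite: LiebWuPhysicaA2003, §5, proof of Theorem 1 and eq. (sigeqn)] -/
theorem liebWuSigmaAtS_eq_kernel_form (hU : 0 < U) (hQ : 0 < Q) (hQπ : Q ≤ π) (hS : MeasurableSet S)
    (Λ : ℝ) :
    liebWuSigmaAtS U Q S Λ = (∫ k in -Q..Q, cauchyDensity (U / 4) (Λ - Real.sin k) * liebWuRhoAtS U Q S k) -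
      ∫ Λ' in S, cauchyDensity (U / 2) (Λ - Λ') * liebWuSigmaAtS U Q S Λ' := by
  have hc : 0 < U / 4 := by positivity
  have h2c : 0 < 2 * (U / 4) := by positivity
  have hU2 : U / 2 = 2 * (U / 4) := by ring
  -- kernels and their bounds
  have hKc : Continuous (cauchyDensity (U / 4)) := continuous_cauchyDensity hc
  have hKB : ∀ y, |cauchyDensity (U / 4) y| ≤ 1 / (π * (U / 4)) := fun y => by
    rw [abs_of_pos (cauchyDensity_pos hc y)]; exact cauchyDensity_le hc y
  have hK2c : Continuous (cauchyDensity (2 * (U / 4))) := continuous_cauchyDensity h2c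
  have hK2i : Integrable (cauchyDensity (2 * (U / 4))) := integrable_cauchyDensity h2c.le
  have hK2B : ∀ y, |cauchyDensity (2 * (U / 4)) y| ≤ 1 / (π * (2 * (U / 4))) := fun y => by
    rw [abs_of_pos (cauchyDensity_pos h2c y)]; exact cauchyDensity_le h2c y
  have hrc : Continuous (sechKernel (U / 4)) := continuous_sechKernel hc
  have hri : Integrable (sechKernel (U / 4)) := integrable_sechKernel hc
  have hrB : ∀ y, |sechKernel (U / 4) y| ≤ 1 / (2 * (U / 4)) := fun y => by
    rw [abs_of_pos (sechKernel_pos hc y)]; exact sechKernel_le hc y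
  have huc : Continuous (fermiKernel (U / 4)) := continuous_fermiKernel hc
  have hui : Integrable (fermiKernel (U / 4)) := integrable_fermiKernel hc
  have huB : ∀ y, |fermiKernel (U / 4) y| ≤ 1 / (2 * π * (U / 4)) := fun y => by
    rw [abs_of_nonneg (fermiKernel_nonneg hc y)]; exact fermiKernel_le hc y
  -- `σ`, its pieces, `G = (1_S σ) ∗ K`, `AG = 1_{(-a,a]} G`
  set σ : ℝ → ℝ := liebWuSigmaAtS U Q S with hσ
  have hσi : Integrable σ := integrable_liebWuSigmaAtS hU hQ hS
  set σS : ℝ → ℝ := S.indicator σ with hσS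
  set σC : ℝ → ℝ := Sᶜ.indicator σ with hσC
  have hσSi : Integrable σS := hσi.indicator hS
  have hσCi : Integrable σC := hσi.indicator hS.compl
  have hsplit : ∀ t, σ t = σS t + σC t := fun t => by
    by_cases ht : t ∈ S
    · rw [hσS, hσC, indicator_of_mem ht, indicator_of_notMem (show t ∉ Sᶜ from fun h' => h' ht), add_zero]
    · rw [hσS, hσC, indicator_of_notMem ht, indicator_of_mem (mem_compl ht), zero_add]
  set G : ℝ → ℝ := fun x => ∫ t, σS t * cauchyDensity (U / 4) (x - t) with hG
  have hGc : Continuous G := continuous_conv₃ hσSi hKc hKB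
  set a : ℝ := Real.sin Q with ha
  have ha0 : 0 ≤ a := Real.sin_nonneg_of_nonneg_of_le_pi hQ.le hQπ
  set AG : ℝ → ℝ := (Ioc (-a) a).indicator G with hAG
  have hAGi : Integrable AG := by
    rw [hAG, integrable_indicator_iff measurableSet_Ioc]
    exact (hGc.integrableOn_Icc).mono_set Ioc_subset_Icc_self
  -- `Ŵσ = ½ AG ∗ r + σC ∗ u` and the fixed point
  have hW : ∀ x, liebWuWS U Q S σ x = 1 / 2 * (∫ t, AG t * sechKernel (U / 4) (x - t)) +
      ∫ t, σC t * fermiKernel (U / 4) (x - t) := by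
    intro x
    rw [liebWuWS, liebWuW]
    congr 2
    refine MeasureTheory.integral_congr_ae (Eventually.of_forall fun t => ?_)
    beta_reduce
    by_cases ht : t ∈ Ioc (-a) a
    · rw [indicator_of_mem ht, hAG, indicator_of_mem ht, one_mul]
    · rw [indicator_of_notMem ht, hAG, indicator_of_notMem ht, zero_mul, zero_mul]
  have hfix : ∀ x, σ x = liebWuXi U Q x + 1 / 2 * (∫ t, AG t * sechKernel (U / 4) (x - t)) +
      ∫ t, σC t * fermiKernel (U / 4) (x - t) := fun x => by
    rw [add_assoc, ← hW x]; exact liebWuSigmaAtS_eq_xi_add_WS hU hQ hS x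
  -- the measure `dk|_{(-Q,Q]}` and `ξ = r ⋄ m /4π`
  set m : Measure ℝ := volume.restrict (Ioc (-Q) Q) with hm
  haveI : IsFiniteMeasure m := by rw [hm]; infer_instance
  have hξ : ∀ x, liebWuXi U Q x = 1 / (4 * π) * ∫ k, sechKernel (U / 4) (x - Real.sin k) ∂m :=
    fun x => congrFun (liebWuXi_eq_integral_restrict hQ U) x
  -- (a) `ξ ∗ K² = S₀ - ξ`
  have hξK2 : ∀ Λ, ∫ t, liebWuXi U Q t * cauchyDensity (2 * (U / 4)) (Λ - t) =
      (1 / (2 * π) * ∫ k, cauchyDensity (U / 4) (Λ - Real.sin k) ∂m) - liebWuXi U Q Λ := by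
    intro Λ
    have hfun : (fun t => liebWuXi U Q t * cauchyDensity (2 * (U / 4)) (Λ - t)) = fun t =>
        1 / (4 * π) * (cauchyDensity (2 * (U / 4)) (Λ - t) *
          ∫ k, sechKernel (U / 4) (t - Real.sin k) ∂m) := by
      funext t; rw [hξ t]; ring
    rw [hfun, MeasureTheory.integral_const_mul,
      integral_mul_integral_comp_sub (m := m) hrc hri Real.continuous_sin
        (h := fun y => cauchyDensity (2 * (U / 4)) (Λ - y))
        (hK2c.comp (continuous_const.sub continuous_id)) (fun y => hK2B (Λ - y))]
    have hinner : ∀ k, ∫ t, cauchyDensity (2 * (U / 4)) (Λ - t) * sechKernel (U / 4) (t - Real.sin k) =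
        2 * cauchyDensity (U / 4) (Λ - Real.sin k) - sechKernel (U / 4) (Λ - Real.sin k) := by
      intro k
      rw [integral_mul_comp_sub_translate (cauchyDensity (2 * (U / 4))) (sechKernel (U / 4)) Λ (Real.sin k),
        integral_sechKernel_mul_cauchyDensity_two_mul hc]
    simp_rw [hinner]
    have hiK : Integrable (fun k => 2 * cauchyDensity (U / 4) (Λ - Real.sin k)) m :=
      integrable_of_continuous_of_abs_le (continuous_const.mul (hKc.comp
        (continuous_const.sub Real.continuous_sin))) (B := 2 * (1 / (π * (U / 4)))) fun k => by
          rw [abs_mul, abs_of_pos (by norm_num : (0 : ℝ) < 2)]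
          exact mul_le_mul_of_nonneg_left (hKB _) (by norm_num)
    have hir : Integrable (fun k => sechKernel (U / 4) (Λ - Real.sin k)) m :=
      integrable_of_continuous_of_abs_le (hrc.comp (continuous_const.sub Real.continuous_sin))
        fun k => hrB _
    rw [integral_sub hiK hir, MeasureTheory.integral_const_mul, hξ Λ]
    ring
  -- (b) `(AG ∗ r) ∗ K² = 2 AG ∗ K - AG ∗ r`
  have hAGrK2 : ∀ Λ, ∫ y, (∫ z, AG z * sechKernel (U / 4) (y - z)) * cauchyDensity (2 * (U / 4)) (Λ - y) =
      2 * (∫ z, AG z * cauchyDensity (U / 4) (Λ - z)) - ∫ z, AG z * sechKernel (U / 4) (Λ - z) := by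
    intro Λ
    rw [conv_conv₃ hAGi hri hK2c hK2B]
    have hin : ∀ z, ∫ s, sechKernel (U / 4) s * cauchyDensity (2 * (U / 4)) (Λ - z - s) =
        2 * cauchyDensity (U / 4) (Λ - z) - sechKernel (U / 4) (Λ - z) := fun z =>
      integral_sechKernel_mul_cauchyDensity_two_mul hc (Λ - z)
    simp_rw [hin]
    rw [conv_sub_right₃ hAGi (g := fun y => 2 * cauchyDensity (U / 4) y) (continuous_const.mul hKc)
      (B := 2 * (1 / (π * (U / 4))))
      (fun y => by rw [abs_mul, abs_of_pos (by norm_num : (0 : ℝ) < 2)]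
                   exact mul_le_mul_of_nonneg_left (hKB y) (by norm_num)) hrc hrB,
      ← MeasureTheory.integral_const_mul]
    congr 1
    refine MeasureTheory.integral_congr_ae (Eventually.of_forall fun z => ?_)
    ring
  -- (b') `(σC ∗ u) ∗ K² = σC ∗ K² - σC ∗ u`
  have hσCuK2 : ∀ Λ, ∫ y, (∫ z, σC z * fermiKernel (U / 4) (y - z)) * cauchyDensity (2 * (U / 4)) (Λ - y) =
      (∫ z, σC z * cauchyDensity (2 * (U / 4)) (Λ - z)) - ∫ z, σC z * fermiKernel (U / 4) (Λ - z) := by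
    intro Λ
    rw [conv_conv₃ hσCi hui hK2c hK2B]
    have hin : ∀ z, ∫ s, fermiKernel (U / 4) s * cauchyDensity (2 * (U / 4)) (Λ - z - s) =
        cauchyDensity (2 * (U / 4)) (Λ - z) - fermiKernel (U / 4) (Λ - z) := fun z =>
      integral_fermiKernel_mul_cauchyDensity_two_mul hc (Λ - z)
    simp_rw [hin]
    exact conv_sub_right₃ hσCi hK2c hK2B huc huB Λ
  -- (c) `σ ∗ K² = S₀ + AG ∗ K + σC ∗ K² - σ`
  have hσK2 : ∀ Λ, ∫ t, σ t * cauchyDensity (2 * (U / 4)) (Λ - t) =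
      (1 / (2 * π) * ∫ k, cauchyDensity (U / 4) (Λ - Real.sin k) ∂m) +
        (∫ z, AG z * cauchyDensity (U / 4) (Λ - z)) + (∫ z, σC z * cauchyDensity (2 * (U / 4)) (Λ - z)) - σ Λ := by
    intro Λ
    have hsplit' : (fun t => σ t * cauchyDensity (2 * (U / 4)) (Λ - t)) = fun t =>
        liebWuXi U Q t * cauchyDensity (2 * (U / 4)) (Λ - t) +
          1 / 2 * ((∫ z, AG z * sechKernel (U / 4) (t - z)) * cauchyDensity (2 * (U / 4)) (Λ - t)) +
          (∫ z, σC z * fermiKernel (U / 4) (t - z)) * cauchyDensity (2 * (U / 4)) (Λ - t) := by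
      funext t; rw [hfix t]; ring
    have hi1 : Integrable fun t => liebWuXi U Q t * cauchyDensity (2 * (U / 4)) (Λ - t) :=
      integrable_mul_sub₃ (integrable_liebWuXi_and_integral hU hQ).1 hK2c hK2B Λ
    have hi2 : Integrable fun t => (∫ z, AG z * sechKernel (U / 4) (t - z)) *
        cauchyDensity (2 * (U / 4)) (Λ - t) :=
      integrable_mul_sub₃ (integrable_conv₃ hAGi hri) hK2c hK2B Λ
    have hi3 : Integrable fun t => (∫ z, σC z * fermiKernel (U / 4) (t - z)) *
        cauchyDensity (2 * (U / 4)) (Λ - t) :=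
      integrable_mul_sub₃ (integrable_conv₃ hσCi hui) hK2c hK2B Λ
    have hi12 : Integrable fun t => liebWuXi U Q t * cauchyDensity (2 * (U / 4)) (Λ - t) +
        1 / 2 * ((∫ z, AG z * sechKernel (U / 4) (t - z)) * cauchyDensity (2 * (U / 4)) (Λ - t)) :=
      hi1.add (hi2.const_mul _)
    rw [hsplit', integral_add hi12 hi3, integral_add hi1 (hi2.const_mul _),
      MeasureTheory.integral_const_mul, hξK2 Λ, hAGrK2 Λ, hσCuK2 Λ, hfix Λ]
    ring
  -- (c') hence `σ + (1_S σ) ∗ K² = S₀ + AG ∗ K`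
  have hσSK2 : ∀ Λ, ∫ t, σS t * cauchyDensity (2 * (U / 4)) (Λ - t) =
      (1 / (2 * π) * ∫ k, cauchyDensity (U / 4) (Λ - Real.sin k) ∂m) +
        (∫ z, AG z * cauchyDensity (U / 4) (Λ - z)) - σ Λ := by
    intro Λ
    have h3 : (∫ t, σ t * cauchyDensity (2 * (U / 4)) (Λ - t)) =
        (∫ t, σS t * cauchyDensity (2 * (U / 4)) (Λ - t)) + ∫ t, σC t * cauchyDensity (2 * (U / 4)) (Λ - t) := by
      rw [← integral_add (integrable_mul_sub₃ hσSi hK2c hK2B Λ) (integrable_mul_sub₃ hσCi hK2c hK2B Λ)]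
      refine MeasureTheory.integral_congr_ae (Eventually.of_forall fun t => ?_)
      beta_reduce
      rw [hsplit t]; ring
    linarith [hσK2 Λ, h3]
  -- (d) the `k`-integral of (14): `∫_{-Q}^{Q} K(Λ - sin k) ρ_S(k) dk = S₀ + AG ∗ K` (substitution `x = sin k`)
  have hT : (∫ k in -Q..Q, cauchyDensity (U / 4) (Λ - Real.sin k) * liebWuRhoAtS U Q S k) =
      (1 / (2 * π) * ∫ k, cauchyDensity (U / 4) (Λ - Real.sin k) ∂m) +
        ∫ z, AG z * cauchyDensity (U / 4) (Λ - z) := by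
    have hKs : Continuous fun k => cauchyDensity (U / 4) (Λ - Real.sin k) := by fun_prop
    have hg : Continuous fun x => cauchyDensity (U / 4) (Λ - x) * G x := by fun_prop
    have hsub := intervalIntegral.integral_comp_mul_deriv (a := -Q) (b := Q)
      (fun k _ => Real.hasDerivAt_sin k) Real.continuous_cos.continuousOn hg
    rw [Real.sin_neg, ← ha] at hsub
    have hρ : ∀ k, cauchyDensity (U / 4) (Λ - Real.sin k) * liebWuRhoAtS U Q S k =
        1 / (2 * π) * cauchyDensity (U / 4) (Λ - Real.sin k) +
          ((fun x => cauchyDensity (U / 4) (Λ - x) * G x) ∘ Real.sin) k * Real.cos k := by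
      intro k
      simp only [liebWuRhoAtS, Function.comp_apply, hG, hσS, hσ]
      ring
    simp_rw [hρ]
    have hi1 : IntervalIntegrable (fun k => 1 / (2 * π) * cauchyDensity (U / 4) (Λ - Real.sin k))
        volume (-Q) Q := (continuous_const.mul hKs).intervalIntegrable _ _
    have hi2 : IntervalIntegrable (fun k => ((fun x => cauchyDensity (U / 4) (Λ - x) * G x) ∘ Real.sin) k *
        Real.cos k) volume (-Q) Q := ((hg.comp Real.continuous_sin).mul Real.continuous_cos).intervalIntegrable _ _
    rw [intervalIntegral.integral_add hi1 hi2, intervalIntegral.integral_const_mul, hsub,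
      intervalIntegral.integral_of_le (by linarith : -a ≤ a),
      ← MeasureTheory.integral_indicator (measurableSet_Ioc : MeasurableSet (Ioc (-a) a)),
      intervalIntegral.integral_of_le (by linarith : -Q ≤ Q), hm]
    congr 1
    refine MeasureTheory.integral_congr_ae (Eventually.of_forall fun t => ?_)
    beta_reduce
    by_cases ht : t ∈ Ioc (-a) a
    · rw [indicator_of_mem ht, hAG, indicator_of_mem ht]; ring
    · rw [indicator_of_notMem ht, hAG, indicator_of_notMem ht, zero_mul]
  -- assemble
  have hSint : ∫ Λ' in S, cauchyDensity (U / 2) (Λ - Λ') * liebWuSigmaAtS U Q S Λ' =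
      ∫ t, σS t * cauchyDensity (2 * (U / 4)) (Λ - t) := by
    rw [← MeasureTheory.integral_indicator hS, hU2]
    refine MeasureTheory.integral_congr_ae (Eventually.of_forall fun t => ?_)
    beta_reduce
    by_cases ht : t ∈ S
    · rw [indicator_of_mem ht, hσS, indicator_of_mem ht, mul_comm]
    · rw [indicator_of_notMem ht, hσS, indicator_of_notMem ht, zero_mul]
  rw [hSint, hT, hσSK2 Λ]
  ring

/-- **Lieb–Wu 2003, Theorem 1 (existence), case `0 < B < ∞`.** For `U > 0`, `0 < Q ≤ π` and `0 < B` the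
Neumann-series pair `(ρ_S, σ_S)`, `S = [-B, B]`, is an `L¹` solution of the Lieb–Wu equations (13)–(14) with
momentum cutoff `Q` and rapidity range `[-B, B]`. [cite: LiebWuPhysicaA2003, §5, Theorem 1] -/
theorem isLiebWuDensities_liebWuRhoAtS_liebWuSigmaAtS (hU : 0 < U) (hQ : 0 < Q) (hQπ : Q ≤ π) {B : ℝ}
    (hB : 0 < B) :
    IsLiebWuDensities U Q (Icc (-B) B) (liebWuRhoAtS U Q (Icc (-B) B)) (liebWuSigmaAtS U Q (Icc (-B) B)) := by
  have hS : MeasurableSet (Icc (-B) B) := measurableSet_Icc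
  refine IsLiebWuDensities.of_kernel_form hQ hQπ (Or.inl ⟨B, hB, rfl⟩)
    ((continuous_liebWuRhoAtS hU hQ hS).intervalIntegrable _ _)
    (integrable_liebWuSigmaAtS hU hQ hS).integrableOn (fun k _ => ?_) (fun Λ _ => ?_)
  · rw [liebWuRhoAtS, ← MeasureTheory.integral_indicator hS]
    congr 2
    refine MeasureTheory.integral_congr_ae (Eventually.of_forall fun t => ?_)
    beta_reduce
    by_cases ht : t ∈ Icc (-B) B
    · rw [indicator_of_mem ht, indicator_of_mem ht, mul_comm]
    · rw [indicator_of_notMem ht, indicator_of_notMem ht, zero_mul]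
  · exact liebWuSigmaAtS_eq_kernel_form hU hQ hQπ hS Λ

/-- **Existence for every finite rapidity range** (statement (a), `0 < B < ∞`): for `U > 0`, `0 < Q ≤ π`,
`0 < B` there is a solution of (13)–(14) with rapidity range `[-B, B]`, with `σ > 0` everywhere.
[cite: LiebWuPRL1968, statement (a)] -/
theorem exists_isLiebWuDensities_Icc (hU : 0 < U) (hQ : 0 < Q) (hQπ : Q ≤ π) {B : ℝ} (hB : 0 < B) :
    ∃ ρ σ : ℝ → ℝ, IsLiebWuDensities U Q (Icc (-B) B) ρ σ ∧ ∀ Λ, 0 < σ Λ :=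
  ⟨_, _, isLiebWuDensities_liebWuRhoAtS_liebWuSigmaAtS hU hQ hQπ hB,
    liebWuSigmaAtS_pos hU hQ measurableSet_Icc⟩

/-- **Existence for every allowed range, `0 < B ≤ ∞`** (statement (a)): for each admissible rapidity range
`SΛ` (`[-B, B]` with `0 < B`, or `ℝ`) the pair `(liebWuRhoAtS U Q SΛ, liebWuSigmaAtS U Q SΛ)` solves (13)–(14).
[cite: LiebWuPRL1968, statement (a)] -/
theorem isLiebWuDensities_liebWuRhoAtS_of_range (hU : 0 < U) (hQ : 0 < Q) (hQπ : Q ≤ π) {SΛ : Set ℝ}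
    (hS : (∃ B : ℝ, 0 < B ∧ SΛ = Icc (-B) B) ∨ SΛ = univ) :
    IsLiebWuDensities U Q SΛ (liebWuRhoAtS U Q SΛ) (liebWuSigmaAtS U Q SΛ) := by
  rcases hS with ⟨B, hB, rfl⟩ | rfl
  · exact isLiebWuDensities_liebWuRhoAtS_liebWuSigmaAtS hU hQ hQπ hB
  · rw [liebWuRhoAtS_univ, liebWuSigmaAtS_univ]
    exact isLiebWuDensities_liebWuRhoAt_liebWuSigmaAt hU hQ hQπ

end Existence

end Literature.MathematicalPhysics.QuantumLattice

end
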